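import Summits.BirchSwinnertonDyer.Rank1Residual.F1Sign2.DoorValueSupplySharpAtTwo
import Summits.BirchSwinnertonDyer.BirchSwinnertonDyer.Theorems.GenusKolyvaginAtTwoGenusPrimitiveSupplyAtTwoTranspositionSelmerTrivialTwin
import Summits.BirchSwinnertonDyer.BirchSwinnertonDyer.Theorems.ByReductionTypeAtTwoRankOneAtTwoBigImageOddLocalOneDoorAnalyticPrimary
import Summits.BirchSwinnertonDyer.BirchSwinnertonDyer.Theorems.ByReductionTypeAtTwoRankOneAtTwoBigImageOddLocalOneDoorGlue
import HarnessLib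

/-!
# Cell `bsd-f1-sign2`, AN residual II at `Δ < 0`, `Ш(W)[2] = 0` half: REDUCED to gk2-p4's Selmer supply (a TREE THEOREM, discharged by name
# here) + ONE named rank-0 hypothesis in REF1's repaired form C′ (-an g16, Sketch_v43 §19; REF1 §140)

PORT (cell `bsd-f1-sign2`, seat `-ty` g12) of §19 (l.1265–1350) of -an g16's `MEMO-an-data/g16/Sketch_v43.lean` b84b51ea1fa811f5 (MEMO-an v1.51
0b1e3037da7c53ff, 2026-08-28T20:29:50Z; = Sketch_v42 23cf2fa3de8ff2fc + §19; §1–§18 are in the tree: `F1Sign2/MinusHalfSumParityAtTwo` …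
`DoorValueSupplySharpAtTwo` (§15–§18, p661739/p666181)).  Typer edits, all mandated by REF1 §140: (1) the rank-0 hypothesis is filed in the
REPAIRED form C′ `RankZeroSelmerTrivialUnitDoorAtTwoOddTam` (REF1 P2a verbatim: `Odd W.tamagawaProduct →` added; the planner's v43
`RankZeroSelmerTrivialUnitDoorAtTwo` is NOT filed — KILLED AS TYPED, numerically false off the slice, see its docstring); (2) the reduction
`nonEggDoorValueSupply_shaTrivial_of_selmerSupply` keeps the planner's name and statement but takes `hR0 : C′` and consumes the slice binder
`htam` (REF1 P2c, proof otherwise verbatim); (3) (c) `TranspSelmerTrivialSupplyAtNegDisc` is kept as the planner's `def` AND discharged by name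
(`transpSelmerTrivialSupplyAtNegDisc_holds`, REF1 P3) from gk2-p4's `GenusKolyTransp.exists_transpAdmissible_door_twistSelmerTwoCard_eq_one`
(p663730); (4) the typer's capstone `nonEggDoorValueSupply_of_oddTam_of_selmerSharp`: residual II (`NonEggDoorValueSupply`) ⇐ PRINT binders
(GZ, Kolyvagin, `exists_isNewformOf`, Hoffstein–Luo) + C′ + AN-33 II″ (§18), bookkeeping only.  Imports: the §18 file + gk2-p4's twin theorem +
the `RankOneAtTwoOneDoor` analytic-primary/glue modules (`mordellWeilRank_eq_one_of_analyticRank_eq_one`, `noRationalTwoTorsion_of_odd_torsionOrder`).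
Nothing here proves BSD; 23715 not closed; no `sorry`, no `@[conjecture]`, no instance, no notation.
REF1 §140 (refuter-bsd-f1-sign2-ref1 g13, `HOME/REF1-AUDIT-v1.md`, evidence `REF1-data/b140/` SHA16.txt — `Probe140.lean` c3361ea0ea4d1916,
`Axioms140.lean` 57d80f6cfb828f8c, kit j317893; 2026-08-28T21:05Z), ONE LINE verbatim: «`RankZeroSelmerTrivialUnitDoorAtTwo` KILLED AS TYPED —
misstated: it quantifies over EVERY globally minimal W with no `Odd W.tamagawaProduct`; door-admissibility makes W^{(d)} ≅ W at every bad
prime, so BSD₂ of the Sel₂-trivial twin gives v₂(L⁄Ω) = v₂∏c(W) + t + 2s > t + 2s whenever ∏c(W) is even, and gk2's own theorem supplies such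
doors; NUMERICALLY FALSE: kit j317893 …: controls 43a1⁄53a1⁄61a1⁄83a1 41⁄41 unit doors, OFF-SLICE 105⁄105 Sel₂-trivial L ≠ 0 doors NOT unit on
16 even-∏c curves … REPAIR C′ = add `Odd W.tamagawaProduct` (`RankZeroSelmerTrivialUnitDoorAtTwoOddTam`, REF1 Probe140.lean P2a) — your §19
reduction re-proves VERBATIM from C′ (P2c⁄P2d, rc 0); … other four §19 decls SURVIVE (`doorAdmissible_of_transpAdmissible` thm; (c) THEOREM
by name; (d),(e) proved glue, std axioms).»  -ty instruction (same line): «do NOT port `RankZeroSelmerTrivialUnitDoorAtTwo` as typed; port C′;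
`TranspSelmerTrivialSupplyAtNegDisc` needs no port — REF1 P3 discharges it BY NAME … rc 0, std axioms» — followed here ((c) kept as text +
discharged, so that MEMO-an v1.51 maps 1:1 and CANDIDATES can record it as KERNEL).
REF2 (refuter-bsd-f1-sign2-ref2 g38/g40; v38 §1 and the 20:29:50Z⁄21:05Z lines): placement UNCHANGED — C′ = rank-0 `2`-converse + `BSD₂`-exactness
for `Sel₂`-trivial twists, «not in print at p = 2» (the ONLY non-print input on residual II's `Ш[2] = 0` half; in print only for inert-prime
twists [cite: Zhai2016, Thm. 1.1, Thm. 1.2] and rational 2-torsion [cite: CaiLiZhai2019]); (c) = tree THEOREM (gk2-p4 p663730: T-q₀ ∘ AN-24S,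
[cite: MazurRubin2010, Prop. 3.3, Cor. 3.4] [cite: Kramer1981, Props. 1–6]); the print binders are [cite: GrossZagier1986] [cite: Kolyvagin1990]
[cite: HoffsteinLuo1997] as carried by `RankOneAtTwoOneDoor.mordellWeilRank_eq_one_of_analyticRank_eq_one`.
PARTITION: none moved; beyond-print theorem: no; BSD not proved; 23715 not closed; bears_on: stmt-BirchSwinnertonDyer-23715, -22136.
-/

set_option autoImplicit false

noncomputable section

open scoped Classical MatrixGroups ModularForm

open CongruenceSubgroup WeierstrassCurve NumberField Literature.NumberTheory.EllipticCurves Literature.NumberTheory.EllipticCurves.ModularForms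
  Literature.NumberTheory.EllipticCurves.Rank1Residual
  Literature.NumberTheory.EllipticCurves.Rank1Residual.Typed
  Summit.BirchSwinnertonDyer.Rank1Residual
  Summit.BirchSwinnertonDyer.Rank1Residual.F1Sign2
  Summit.BirchSwinnertonDyer.Rank1Residual.F1Sign2.TranspositionDoor
  Summit.BirchSwinnertonDyer.BirchSwinnertonDyer.Theorems.RankOneAtTwoOneDoor

namespace Summit.BirchSwinnertonDyer.Rank1Residual.F1Sign2.ANg16

/-! ### §19 (v43) — residual II (`Δ < 0`), `Ш(W)[2] = 0` half, REDUCED to gk2-p4's Selmer supply + ONE named rank-0 hypothesis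

gk2-p4 g13 (WIDTH-5, p663730) landed `GenusKolyTransp.exists_transpAdmissible_door_twistSelmerTwoCard_eq_one`: every `Δ < 0` rank-one curve
with `E(ℚ)[2] = 0` and `Ш(W)[2] = 0` has a transposition-admissible prime Heegner twist with `#Sel₂(W^{(d_K)}) = 1` — the SELMER SHADOW of the
`(t, s) = (1, 0)` unit doors ENGINE U finds on the `Δ < 0` slice (1 605/1 605 doors with `#Sel₂ = 1`, r6).  What is left for the VALUE
statement on this half is the single named hypothesis `RankZeroSelmerTrivialUnitDoorAtTwo` (rank-0 `2`-converse + `BSD₂`-exactness for the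
`Sel₂`-trivial twin; REF2 v38 §1: not in print at `p = 2`).  By name: odd torsion ⇒ `E(ℚ)[2] = 0` (`RankOneAtTwoOneDoor.noRationalTwoTorsion_of_odd_torsionOrder`),
analytic rank one ⇒ rank one (`RankOneAtTwoOneDoor.mordellWeilRank_eq_one_of_analyticRank_eq_one`, mod the route's standing print binders
GZ / Kolyvagin / modularity / Hoffstein–Luo). -/

section ResidualIIShaTrivial

open Summit.BirchSwinnertonDyer.BirchSwinnertonDyer.Theorems.RankOneAtTwoOneDoor
  Summit.BirchSwinnertonDyer.Rank1Residual.F1Sign2.TranspositionDoor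

/-- `TranspAdmissible W d q₀ ⇒ DoorAdmissible W d` (the one-transposition parameter is a door parameter). -/
theorem doorAdmissible_of_transpAdmissible (W : WeierstrassCurve ℚ) [W.IsGloballyMinimal] {d : ℤ} {q₀ : ℕ}
    (h : TranspAdmissible W d q₀) : DoorAdmissible W d := by
  obtain ⟨hneg, hsq, h8, _, _, _, hq, hℓ⟩ := h
  exact ⟨hneg, hsq, h8, fun q hq' hqd hF => (hq q hq' hqd).1 hF, hℓ⟩

/-- **Named rank-0 hypothesis, REF1-REPAIRED FORM C′ `RankZeroSelmerTrivialUnitDoorAtTwoOddTam` (REF1 §140 P2a VERBATIM; NOT in print at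
`p = 2`; conjecture-grade).**  The planner's v43 form `RankZeroSelmerTrivialUnitDoorAtTwo` (the statement below WITHOUT `Odd W.tamagawaProduct`)
was KILLED AS TYPED by REF1 §140: it quantifies over every globally minimal `W`; door-admissibility makes `W^{(d)} ≅ W` at every bad prime, so
`BSD₂` of the `Sel₂`-trivial twin gives `v₂(L/Ω) = v₂ ∏c(W) + t + 2s > t + 2s` whenever `∏c(W)` is even — NUMERICALLY FALSE off the slice
(kit j317893, REF1 engine with ENGINE U conventions: 105/105 `Sel₂`-trivial `L ≠ 0` doors NOT unit on 16 even-`∏c` curves; simplest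
`W` = 88a1, `d = −7`: `L/Ω = 8`, `v₂ = 3 > 1`; 446a1, `d = −95`, `(t,s) = (2,0)`: `3 > 2`).  REPAIR C′ = add `Odd W.tamagawaProduct`; the §19
reduction below re-proves VERBATIM from C′ (REF1 P2c: the slice binder, unused in the planner's proof, is exactly what C′ consumes); the
planner's Prop implies C′ (REF1 P2b).  -an asked (v44) to retype (b) → C′ and re-read every door-VALUE statement for the same omission.
Planner's docstring (v43, for the unrepaired form): a door-admissible twist
parameter `d` of a globally minimal `W` with `#Sel₂(W^{(d)}) = 1` is a UNIT DOOR in value currency (`DoorUnitValueAt W d`: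
`L(W^{(d)},1) ≠ 0` and `ord₂ (L(Wd,1)/Ω(Wd)) ≤ t + 2s` on a minimal model `Wd`).  = rank-0 `2`-converse + `BSD₂`-exactness for the
`Sel₂`-trivial twin.  Why it might fail: it is the `2`-part of BSD for rank-0 curves with trivial `2`-Selmer group (value side), where no
Iwasawa main conjecture at `p = 2` is available; census: ENGINE U/I (every `(1,0)` door found is a unit door AND has `#Sel₂ = 1`, 1 605 doors). -/
def RankZeroSelmerTrivialUnitDoorAtTwoOddTam : Prop :=
  ∀ (W : WeierstrassCurve ℚ) [W.IsElliptic] [W.IsGloballyMinimal] (d : ℤ),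
    Odd W.tamagawaProduct → DoorAdmissible W d → twistSelmerTwoCard W d = 1 → DoorUnitValueAt W d

/-- **gk2-p4's unconditional Selmer supply, BY SHAPE** (= the tree theorem
`GenusKolyTransp.exists_transpAdmissible_door_twistSelmerTwoCard_eq_one`, p663730, with its door-open / coprimality / Heegner conjuncts
dropped; stated as a named `Prop` (the planner's v43 text, kept so that the memo maps 1:1) and DISCHARGED BY NAME just below (`transpSelmerTrivialSupplyAtNegDisc_holds`):
`fun W _ _ _ hΔ hT hr hS => by obtain ⟨K, a, b, q₀, c, hK, hadm, -, -, -, h⟩ := exists_transpAdmissible_door_twistSelmerTwoCard_eq_one W hΔ hT hr hS;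
exact ⟨K, a, b, q₀, c, hK, hadm, h⟩`). -/
def TranspSelmerTrivialSupplyAtNegDisc : Prop :=
  ∀ (W : WeierstrassCurve ℚ) [W.IsElliptic] [W.IsGloballyMinimal] [NeZero (W.conductorNorm ℤ)],
    W.Δ < 0 → NoRationalTwoTorsion W → W.mordellWeilRank = 1 → ShaTwoTrivial W →
    ∃ (K : Type) (_ : Field K) (_ : NumberField K) (q₀ : ℕ) (_ : Fact q₀.Prime),
      IsImaginaryQuadratic K ∧ TranspAdmissible W (NumberField.discr K) q₀ ∧ twistSelmerTwoCard W (NumberField.discr K) = 1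

/-- **(c) is a TREE THEOREM**: `TranspSelmerTrivialSupplyAtNegDisc` discharged BY NAME from gk2-p4's
`GenusKolyTransp.exists_transpAdmissible_door_twistSelmerTwoCard_eq_one` (p663730) — the planner's one-liner, checked by REF1 §140 P3
(std axioms). PROVED. -/
theorem transpSelmerTrivialSupplyAtNegDisc_holds : TranspSelmerTrivialSupplyAtNegDisc := by
  intro W _ _ _ hΔ hT hr hS
  obtain ⟨K, a, b, q₀, c, hK, hadm, -, -, -, h⟩ :=
    Summit.BirchSwinnertonDyer.BirchSwinnertonDyer.Theorems.GenusKolyTransp.exists_transpAdmissible_door_twistSelmerTwoCard_eq_one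
      W hΔ hT hr hS
  exact ⟨K, a, b, q₀, c, hK, hadm, h⟩

/-- **Residual II, `Ш(W)[2] = 0` half, mod print + gk2-p4's Selmer supply (a tree THEOREM, here by shape) + ONE named rank-0 hypothesis
(PROVED reduction).**  gk2-p4's unconditional Selmer supply
(`exists_transpAdmissible_door_twistSelmerTwoCard_eq_one`) + `RankZeroSelmerTrivialUnitDoorAtTwoOddTam` (C′) ⇒ every slice curve with `Δ < 0` and
`Ш(W)[2] = 0` has a door-admissible unit door (indeed a ONE-TRANSPOSITION door, `(t, s) = (1, 0)`). -/
theorem nonEggDoorValueSupply_shaTrivial_of_selmerSupply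
    (hGZ : ∀ (N : ℕ) [NeZero N] (W : WeierstrassCurve ℚ) (K : Type) [Field K] [NumberField K], gross_zagier N W K)
    (hKo : ∀ (N : ℕ) [NeZero N] (W : WeierstrassCurve ℚ) (K : Type) [Field K] [NumberField K], kolyvagin N W K)
    (hnf : exists_isNewformOf) (hHL : HoffsteinLuo1997_exists_twist_L_one_ne_zero)
    (hSelSupply : TranspSelmerTrivialSupplyAtNegDisc) (hR0 : RankZeroSelmerTrivialUnitDoorAtTwoOddTam) :
    ∀ (W : WeierstrassCurve ℚ) [W.IsElliptic] [W.IsGloballyMinimal] [NeZero (W.conductorNorm ℤ)],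
    ¬ W.HasCM → (∀ n : ℕ, W.HasSurjectiveModNGaloisRep ((2 ^ n : ℕ) : ℤ)) → Odd W.torsionOrder → Odd W.tamagawaProduct →
    W.analyticRank = 1 → W.Δ < 0 → ShaTwoTrivial W →
    ∃ (K : Type) (_ : Field K) (_ : NumberField K), IsImaginaryQuadratic K ∧ DoorAdmissible W (NumberField.discr K) ∧
      DoorUnitValueAt W (NumberField.discr K) := by
  intro W _ _ _ _ _ htor htam hrk hneg hSha
  have hT : NoRationalTwoTorsion W := noRationalTwoTorsion_of_odd_torsionOrder W htor
  have hrank : W.mordellWeilRank = 1 := (mordellWeilRank_eq_one_of_analyticRank_eq_one hGZ hKo hnf hHL W hrk).1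
  obtain ⟨K, hF, hNF, q₀, hq₀, hK, hadm, hSel⟩ := hSelSupply W hneg hT hrank hSha
  exact ⟨K, hF, hNF, hK, doorAdmissible_of_transpAdmissible W hadm,
    hR0 W (NumberField.discr K) htam (doorAdmissible_of_transpAdmissible W hadm) hSel⟩

/-- **Residual II assembled from its two halves (PROVED glue):** the `Ш[2] = 0` half above and ANY supply statement for the `Ш[2] ≠ 0`
half (e.g. AN-33 II″ `NegDiscShaTwoDoorValueSupplySelmerSharp` of `Sketch_v42` §18, through `nonEggDoorValueSupply_shaTwo_of_selmerSharp`)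
give the tree's `NonEggDoorValueSupply`. -/
theorem nonEggDoorValueSupply_of_halves
    (h0 : ∀ (W : WeierstrassCurve ℚ) [W.IsElliptic] [W.IsGloballyMinimal] [NeZero (W.conductorNorm ℤ)],
      ¬ W.HasCM → (∀ n : ℕ, W.HasSurjectiveModNGaloisRep ((2 ^ n : ℕ) : ℤ)) → Odd W.torsionOrder → Odd W.tamagawaProduct →
      W.analyticRank = 1 → W.Δ < 0 → ShaTwoTrivial W →
      ∃ (K : Type) (_ : Field K) (_ : NumberField K), IsImaginaryQuadratic K ∧ DoorAdmissible W (NumberField.discr K) ∧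
        DoorUnitValueAt W (NumberField.discr K))
    (h1 : ∀ (W : WeierstrassCurve ℚ) [W.IsElliptic] [W.IsGloballyMinimal] [NeZero (W.conductorNorm ℤ)],
      ¬ W.HasCM → (∀ n : ℕ, W.HasSurjectiveModNGaloisRep ((2 ^ n : ℕ) : ℤ)) → Odd W.torsionOrder → Odd W.tamagawaProduct →
      W.analyticRank = 1 → W.Δ < 0 → ¬ ShaTwoTrivial W →
      ∃ (K : Type) (_ : Field K) (_ : NumberField K), IsImaginaryQuadratic K ∧ DoorAdmissible W (NumberField.discr K) ∧
        DoorUnitValueAt W (NumberField.discr K)) :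
    NonEggDoorValueSupply := by
  intro W _ _ _ hCM hsurj htor htam hrk hneg
  by_cases hSha : ShaTwoTrivial W
  · exact h0 W hCM hsurj htor htam hrk hneg hSha
  · exact h1 W hCM hsurj htor htam hrk hneg hSha

/-- **Residual II (`NonEggDoorValueSupply`) ⇐ PRINT (GZ, Kolyvagin, modularity, Hoffstein–Luo) + C′ + AN-33 II″** — the two named
non-print inputs of the `Δ < 0` residual, with gk2-p4's Selmer supply discharged by name (typer's assembly of (d), (e), §18's
`nonEggDoorValueSupply_shaTwo_of_selmerSharp` and `transpSelmerTrivialSupplyAtNegDisc_holds`; PROVED, bookkeeping only). -/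
theorem nonEggDoorValueSupply_of_oddTam_of_selmerSharp
    (hGZ : ∀ (N : ℕ) [NeZero N] (W : WeierstrassCurve ℚ) (K : Type) [Field K] [NumberField K], gross_zagier N W K)
    (hKo : ∀ (N : ℕ) [NeZero N] (W : WeierstrassCurve ℚ) (K : Type) [Field K] [NumberField K], kolyvagin N W K)
    (hnf : exists_isNewformOf) (hHL : HoffsteinLuo1997_exists_twist_L_one_ne_zero)
    (hR0 : RankZeroSelmerTrivialUnitDoorAtTwoOddTam) (hII : NegDiscShaTwoDoorValueSupplySelmerSharp) :
    NonEggDoorValueSupply :=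
  nonEggDoorValueSupply_of_halves
    (nonEggDoorValueSupply_shaTrivial_of_selmerSupply hGZ hKo hnf hHL transpSelmerTrivialSupplyAtNegDisc_holds hR0)
    (nonEggDoorValueSupply_shaTwo_of_selmerSharp hII)

end ResidualIIShaTrivial

end Summit.BirchSwinnertonDyer.Rank1Residual.F1Sign2.ANg16

end
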